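/-
Origin: expansion seat `planner-pub-hodgecm-mc-theta-3-g13-0`, handover (K9) 2026-08-20T09:32:28Z md5 8b0eb7be6149831689e80ca7ec17d935 (429 l.; NEW additive drop-alone leaf over RUN-44 (BF) `ArchSlotBoxFock` + RUN-46 (K7) `ArchConjTorusTransport`; Folland-frame transport J_S with Φ_{X'} ∘ J_S = Φ_X (theta half of (VT)); cert rc 0/0 warn/0 proof holes; axioms 41/41 ⊆ trio) (`HOME/mc/pub-hodgecm-mc-theta-3-g13/lean/stage47/HodgeCM/Model/ArchConjFrameTransport.lean`, md5 8b0eb7be6149, 429 lines);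
landed by the gen-18 packager (p-g18) in gate run 47 as `HodgeCM/Model/ArchConjFrameTransport.lean` (verbatim).
-/
/-
Origin: speedrun cell pub-hodgecm, MODEL-CONSTRUCTION sub-cell, lineage mc-theta-3 (theta supply / second-lift lane, BINDER-OWNERS row 5 `S` slot),
seat planner-pub-hodgecm-mc-theta-3-g13-0 (gen 13), 2026-08-20.  Target in PKG: `HodgeCM/Model/ArchConjFrameTransport.lean`
(NEW additive drop-alone leaf; imports (BF) `Model/ArchSlotBoxFock`, (BT) `Model/ArchSlotBoxTorus` via (K7) `Model/ArchConjTorusTransport`).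
KERNEL only: 0 records / `def … : Prop` / cites, 0 proof holes; intended closure {propext, Classical.choice, Quot.sound}.
-/
import Summits.HodgeConjecture.HodgeCM.Model.ArchSlotBoxFock
import Summits.HodgeConjecture.HodgeCM.Model.ArchConjTorusTransport_2

/-!
# (J-μ) slots 2/3, theta half of (VT): the Folland-frame transport `J_S` with `Φ_{X'} ∘ J_S = Φ_X`

(K7) `Model/ArchConjTorusTransport` built the place-wise permutation-and-rescaling `M_w` (`transportMatAt`) with
`M_wᴴ · diag(w ∘ dW') · M_w = diag(w ∘ dW)` and the conjugating element `k = archGL(isoGL) · M ∈ U(diag dW)(L ⊗ ℝ)`.  The remaining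
archimedean input (VT) of sinst-1's #1217 `slotTypeVec_sub_eq_of_conj_transport` asks that the archimedean factor `Y` of the conjugated
see-saw tensor be `a • ω_∞(hGR)(1, k) Φ_X`.  The see-saw element is `(1 ⊗ k) ∘ (1 ⊗ M⁻¹)` with `1 ⊗ M⁻¹` REAL (a point transformation of
the Schrödinger Lagrangian), so (VT) splits into an operator statement about implementers (W2-⊗ / binder-2) and ONE Schwartz-function
identity, proved here:

* §1 the plane frame and the slot box for ARBITRARY letters `a : Fin 2 → L` (the verbatim generalisation of (BF) §2–§4 from `dW S` to `a`;
  at `a := dW S` it is (BF) by `rfl`, at `a := dW' S` it is the primed plane): `planeFrame`, `slotPlacePolyOf`,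
  **`slotArchBox_linePhi_eq_follandFock_of`**;
* §2 the place polynomial does not see the letter: **`linePlacePoly_letter_indep`**, `slotPlacePolyOf_eq` (both boxes carry the SAME
  polynomial `∏_w slotPlacePoly_w`, the primed one in the primed frame);
* §3 the column swap `slotColSwap` and its place-wise version `colPermAt S v` (swap the two line columns at the real places `v` under a
  place where (K7)'s bit `conjSwapAt S` is set), the index relabelling `conjColPerm S`, and the invariance
  **`rename_conjColPerm_prod_slotPlacePoly`** (the place product is column-symmetric);
* §4 **`conjFrameTransport V S := 𝔢⁻¹_{X'} ∘ (relabel by conjColPerm S) ∘ 𝔢_X`**, a continuous linear automorphism of `(L⁺ ⊗ ℝ)^{3·2}`, and the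
  HEADLINE **`slotArchBox_linePhi_conjFrameTransport`**:
  `Φ_{X'} (conjFrameTransport V S y) = Φ_X y` for `Φ_X = slotArchBox (linePhi (dW S 0)) (linePhi (dW S 1))`,
  `Φ_{X'} = slotArchBox (linePhi (dW' S 0)) (linePhi (dW' S 1))`; as Schwartz maps
  **`compCLMOfContinuousLinearEquiv ℂ (conjFrameTransport V S) Φ_{X'} = Φ_X`**;
* §5 the coordinates of `J_S`: `(J_S y)_{(i,j),v} = (D^X_W(v, σ_v j) / D^{X'}_W(v, j)) · y_{(i, σ_v j),v}` (`conjFrameTransport_apply_fst`), i.e.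
  `J_S = 1_V ⊗ M` column by column.

Nothing here is a claim of PerL/QW8; nothing is cited as a fact.
-/

set_option autoImplicit false

noncomputable section

open scoped Matrix Classical SchwartzMap TensorProduct
open MvPolynomial (rename)
open NumberField (InfinitePlace maximalRealSubfield IsCMField)
open NumberField.mixedEmbedding (mixedSpace)
open Literature.NumberTheory.Automorphic Literature.NumberTheory.Automorphic.UnitaryGroup Literature.NumberTheory.Weil1964
open Literature.RepresentationTheory.KonnoKonno2007 Literature.RepresentationTheory.KonnoKonno2007.RealDualPair
open Literature.NumberTheory.GelbartRogawski1991 Literature.NumberTheory.GelbartRogawski1991.UnitaryDualPair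
open Literature.RepresentationTheory (atPlace)
open Literature.Analysis.SegalBargmann
open HodgeCM.Adelic HodgeCM.PerL34 HodgeCM.Model.HypCensus

namespace HodgeCM.Model.ArchSideTerm

/-! ## §1 the plane frame and the slot box for arbitrary letters -/

section Letters

variable {L : CMField} {ι₁ : L →+* ℂ} (V : HermSpace3 L ι₁)
variable (a : Fin 2 → (L : Type)) (ha : ∀ j, IsCMField.complexConj (L : Type) (a j) = a j) (ha0 : ∀ j, a j ≠ 0)

/-- the plane frame `𝔢 = cmBigFrame (frameD V ⊗ a)` on `(L⁺ ⊗ ℝ)^{3·2}` for the letters `a` ((BF) `slotFrame V S` is `a := dW S`). -/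
abbrev planeFrame :
    (Fin (3 * 2) → mixedSpace (↥(maximalRealSubfield (L : Type)))) ≃L[ℝ]
      (Fin (3 * 2) × {v : InfinitePlace (↥(maximalRealSubfield (L : Type))) // v.IsReal} → ℝ) :=
  cmBigFrame (L : Type) finProdFinEquiv (frameD V) (frameD_real V) (frameD_ne V) a ha ha0 ι₁

/-- the line frame of the letter `a k`. -/
abbrev lineFrameOf (k : Fin 2) :
    (Fin 3 → mixedSpace (↥(maximalRealSubfield (L : Type)))) ≃L[ℝ]
      (Fin 3 × {v : InfinitePlace (↥(maximalRealSubfield (L : Type))) // v.IsReal} → ℝ) :=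
  cmBigFrame (L : Type) e₁ (frameD V) (frameD_real V) (frameD_ne V) (lineVec (L : Type) (a k)) (fun _ => ha k) (fun _ => ha0 k) ι₁

/-- (Ported verbatim from the HodgeCMPerL package; no docstring in the source.) -/
theorem planeFrame_dW (S : StubTree.SeesawDatum L) : planeFrame V (dW S) (dW_real S) (dW_ne S) = slotFrame V S := rfl

/-- (Ported verbatim from the HodgeCMPerL package; no docstring in the source.) -/
theorem lineFrameOf_dW (S : StubTree.SeesawDatum L) (k : Fin 2) : lineFrameOf V (dW S) (dW_real S) (dW_ne S) k = lineFrame V S k := rfl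

/-- column 0 of the plane frame is the line-0 frame. -/
theorem planeFrame_slotIdx_inl (x : Fin (3 * 2) → mixedSpace (↥(maximalRealSubfield (L : Type)))) (i : Fin 3)
    (v : {v : InfinitePlace (↥(maximalRealSubfield (L : Type))) // v.IsReal}) :
    planeFrame V a ha ha0 x (slotIdx _ (Sum.inl (i, v))) = lineFrameOf V a ha ha0 0 (fun i' => x (slotCol (Sum.inl i'))) (i, v) := by
  rw [slotIdx_inl, scaledFrame_apply, scaledFrame_apply]
  change cmDV (L : Type) (frameD V) (frameD_real V) ι₁ v (finProdFinEquiv.symm (slotCol (Sum.inl i))).1 *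
      cmDW (L : Type) (frameD V) a ha ι₁ v (finProdFinEquiv.symm (slotCol (Sum.inl i))).2 * (x (slotCol (Sum.inl i))).1 v =
    cmDV (L : Type) (frameD V) (frameD_real V) ι₁ v (e₁.symm i).1 *
      cmDW (L : Type) (frameD V) (lineVec (L : Type) (a 0)) (fun _ => ha 0) ι₁ v (e₁.symm i).2 * (x (slotCol (Sum.inl i))).1 v
  rw [finProdFinEquiv_symm_slotCol_inl, e₁_symm_apply]
  rfl

/-- column 1 of the plane frame is the line-1 frame. -/
theorem planeFrame_slotIdx_inr (x : Fin (3 * 2) → mixedSpace (↥(maximalRealSubfield (L : Type)))) (i : Fin 3)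
    (v : {v : InfinitePlace (↥(maximalRealSubfield (L : Type))) // v.IsReal}) :
    planeFrame V a ha ha0 x (slotIdx _ (Sum.inr (i, v))) = lineFrameOf V a ha ha0 1 (fun i' => x (slotCol (Sum.inr i'))) (i, v) := by
  rw [slotIdx_inr, scaledFrame_apply, scaledFrame_apply]
  change cmDV (L : Type) (frameD V) (frameD_real V) ι₁ v (finProdFinEquiv.symm (slotCol (Sum.inr i))).1 *
      cmDW (L : Type) (frameD V) a ha ι₁ v (finProdFinEquiv.symm (slotCol (Sum.inr i))).2 * (x (slotCol (Sum.inr i))).1 v =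
    cmDV (L : Type) (frameD V) (frameD_real V) ι₁ v (e₁.symm i).1 *
      cmDW (L : Type) (frameD V) (lineVec (L : Type) (a 1)) (fun _ => ha 1) ι₁ v (e₁.symm i).2 * (x (slotCol (Sum.inr i))).1 v
  rw [finProdFinEquiv_symm_slotCol_inr, e₁_symm_apply]
  rfl

/-- `slotArchBox (𝔢₀-Fock of G₀) (𝔢₁-Fock of G₁) = 𝔢-Fock of (G₀ ⊗ G₁) ∘ slotIdx⁻¹`, letters `a`. -/
theorem slotArchBox_follandFock_of
    (G₀ G₁ : MvPolynomial (Fin 3 × {v : InfinitePlace (↥(maximalRealSubfield (L : Type))) // v.IsReal}) ℂ) :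
    slotArchBox (follandFock (lineFrameOf V a ha ha0 0) G₀) (follandFock (lineFrameOf V a ha ha0 1) G₁) =
      follandFock (planeFrame V a ha ha0) (rename (slotIdx _) (rename Sum.inl G₀ * rename Sum.inr G₁)) := by
  ext x
  simp only [slotArchBox, schwartzReindexCLM_apply, archBoxTensor_apply, follandFock, schwartzTransport_symm_apply]
  rw [← schwartzTransport_relabelCLE_binvPi, schwartzTransport_apply, binvPi_rename_mul, tensorPi_apply]
  have h₀ : ((relabelCLE (slotIdx {v : InfinitePlace (↥(maximalRealSubfield (L : Type))) // v.IsReal})).symm (planeFrame V a ha ha0 x)) ∘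
      Sum.inl = lineFrameOf V a ha ha0 0 (fun i' => x (slotCol (Sum.inl i'))) := by
    funext k
    obtain ⟨i, v⟩ := k
    rw [Function.comp_apply, relabelCLE_symm_apply]
    exact planeFrame_slotIdx_inl V a ha ha0 x i v
  have h₁ : ((relabelCLE (slotIdx {v : InfinitePlace (↥(maximalRealSubfield (L : Type))) // v.IsReal})).symm (planeFrame V a ha ha0 x)) ∘
      Sum.inr = lineFrameOf V a ha ha0 1 (fun i' => x (slotCol (Sum.inr i'))) := by
    funext k
    obtain ⟨i, v⟩ := k
    rw [Function.comp_apply, relabelCLE_symm_apply]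
    exact planeFrame_slotIdx_inr V a ha ha0 x i v
  rw [h₀, h₁]
  rfl

variable
  (hp₀ : 0 < cmXW (L : Type) (frameD V) (lineVec (L : Type) (a 0)) (fun _ => ha 0) ι₁ (HypCensus.cmPlace (L : Type) ι₁) 0)
  (hp₁ : 0 < cmXW (L : Type) (frameD V) (lineVec (L : Type) (a 1)) (fun _ => ha 1) ι₁ (HypCensus.cmPlace (L : Type) ι₁) 0)

/-- the place polynomials of the slot box of the letters `a` ((BF) `slotPlacePoly V S` is `a := dW S`). -/
def slotPlacePolyOf (w : {v : InfinitePlace (↥(maximalRealSubfield (L : Type))) // v.IsReal}) : MvPolynomial (Fin (3 * 2)) ℂ :=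
  rename (fun i => slotCol (Sum.inl i))
      (linePlacePoly Empty (L : Type) e₁ (frameD V) (frameD_real V) (lineVec (L : Type) (a 0)) (fun _ => ha 0) ι₁
        (blockPosEquiv V) (blockNegEquiv V) (posIdxEquivUnit hp₀) (negIdxEquivEmpty hp₀) (Pi.single 0 1) w) *
    rename (fun i => slotCol (Sum.inr i))
      (linePlacePoly Empty (L : Type) e₁ (frameD V) (frameD_real V) (lineVec (L : Type) (a 1)) (fun _ => ha 1) ι₁
        (blockPosEquiv V) (blockNegEquiv V) (posIdxEquivUnit hp₁) (negIdxEquivEmpty hp₁) (Pi.single 0 1) w)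

/-- **the slot box of the two line vectors of the letters `a` is the `a`-plane-frame Fock vector of `∏_w slotPlacePolyOf w`.** -/
theorem slotArchBox_linePhi_eq_follandFock_of :
    slotArchBox (linePhi V (a 0) (ha 0) (ha0 0) hp₀) (linePhi V (a 1) (ha 1) (ha0 1) hp₁) =
      follandFock (planeFrame V a ha ha0) (∏ w, rename (atPlace w) (slotPlacePolyOf V a ha hp₀ hp₁ w)) := by
  rw [linePhi_eq_follandFock, linePhi_eq_follandFock]
  change slotArchBox (follandFock (lineFrameOf V a ha ha0 0) _) (follandFock (lineFrameOf V a ha ha0 1) _) = _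
  rw [slotArchBox_follandFock_of, rename_slotIdx_prod_atPlace]
  rfl

end Letters

/-! ## §2 the place polynomial does not see the letter -/

section Indep

variable {L : CMField} {ι₁ : L →+* ℂ} (V : HermSpace3 L ι₁)

/-- the coordinate of the degree-one block index `(p, ⋆)` of a positive line in the line's index set `Fin 3` does not depend on the line:
it is `e₁ (ε_V⁻¹ (inl (eP⁻¹ p)), 0)`. -/
theorem cmPlaceIdxAt_symm_inl_inl (d : (L : Type)) (hd : IsCMField.complexConj (L : Type) d = d)
    (hpos : 0 < cmXW (L : Type) (frameD V) (lineVec (L : Type) d) (fun _ => hd) ι₁ (HypCensus.cmPlace (L : Type) ι₁) 0) (pr : Fin 2 × Unit) :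
    (cmPlaceIdxAt (L : Type) e₁ (frameD V) (frameD_real V) (lineVec (L : Type) d) (fun _ => hd) ι₁ (HypCensus.cmPlace (L : Type) ι₁)
        (blockPosEquiv V) (blockNegEquiv V) (posIdxEquivUnit hpos) (negIdxEquivEmpty hpos)).symm (Sum.inl (Sum.inl pr)) =
      e₁ ((cmEpsV (L : Type) (frameD V) (frameD_real V) ι₁ (HypCensus.cmPlace (L : Type) ι₁)).symm (Sum.inl ((blockPosEquiv V).symm pr.1)), 0) := by
  simp only [cmPlaceIdxAt, pairFrame, Equiv.symm_trans_apply, Equiv.symm_symm, dpIdxCongr, Equiv.sumCongr_symm, Equiv.sumCongr_apply,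
    Sum.map_inl, Equiv.prodCongr_symm, Equiv.prodCongr_apply, Prod.map, dpEquiv_symm_inl_inl]
  exact congrArg e₁ (Prod.ext rfl (Subsingleton.elim _ _))

/-- **the line's place polynomial does not depend on the (positive) letter.** -/
theorem linePlacePoly_letter_indep (d d' : (L : Type)) (hd : IsCMField.complexConj (L : Type) d = d) (hd' : IsCMField.complexConj (L : Type) d' = d')
    (hpos : 0 < cmXW (L : Type) (frameD V) (lineVec (L : Type) d) (fun _ => hd) ι₁ (HypCensus.cmPlace (L : Type) ι₁) 0)
    (hpos' : 0 < cmXW (L : Type) (frameD V) (lineVec (L : Type) d') (fun _ => hd') ι₁ (HypCensus.cmPlace (L : Type) ι₁) 0)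
    (w : {v : InfinitePlace (↥(maximalRealSubfield (L : Type))) // v.IsReal}) :
    linePlacePoly Empty (L : Type) e₁ (frameD V) (frameD_real V) (lineVec (L : Type) d) (fun _ => hd) ι₁
        (blockPosEquiv V) (blockNegEquiv V) (posIdxEquivUnit hpos) (negIdxEquivEmpty hpos) (Pi.single 0 1) w =
      linePlacePoly Empty (L : Type) e₁ (frameD V) (frameD_real V) (lineVec (L : Type) d') (fun _ => hd') ι₁
        (blockPosEquiv V) (blockNegEquiv V) (posIdxEquivUnit hpos') (negIdxEquivEmpty hpos') (Pi.single 0 1) w := by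
  by_cases hw : w = HypCensus.cmPlace (L : Type) ι₁
  · subst hw
    rw [linePlacePoly_same, linePlacePoly_same]
    simp only [degOnePoly, map_sum, map_smul, rename_zeta_single, cmPlaceIdxAt_symm_inl_inl]
  · rw [linePlacePoly_of_ne _ _ _ _ _ _ _ _ _ _ _ _ _ hw, linePlacePoly_of_ne _ _ _ _ _ _ _ _ _ _ _ _ _ hw]

variable (S : StubTree.SeesawDatum L)
variable
  (hpos₀ : 0 < cmXW (L : Type) (frameD V) (lineVec (L : Type) (dW S 0)) (fun _ => dW_real S 0) ι₁ (HypCensus.cmPlace (L : Type) ι₁) 0)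
  (hpos₁ : 0 < cmXW (L : Type) (frameD V) (lineVec (L : Type) (dW S 1)) (fun _ => dW_real S 1) ι₁ (HypCensus.cmPlace (L : Type) ι₁) 0)
  (hpos₂ : 0 < cmXW (L : Type) (frameD V) (lineVec (L : Type) (dW' S 0)) (fun _ => dW'_real S 0) ι₁ (HypCensus.cmPlace (L : Type) ι₁) 0)
  (hpos₃ : 0 < cmXW (L : Type) (frameD V) (lineVec (L : Type) (dW' S 1)) (fun _ => dW'_real S 1) ι₁ (HypCensus.cmPlace (L : Type) ι₁) 0)

/-- **the primed slot box carries the unprimed place polynomials**: `slotPlacePolyOf (dW' S) = slotPlacePoly V S`. -/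
theorem slotPlacePolyOf_dW'_eq (w : {v : InfinitePlace (↥(maximalRealSubfield (L : Type))) // v.IsReal}) :
    slotPlacePolyOf V (dW' S) (dW'_real S) hpos₂ hpos₃ w = slotPlacePoly V S hpos₀ hpos₁ w := by
  unfold slotPlacePolyOf slotPlacePoly
  rw [linePlacePoly_letter_indep V (dW' S 0) (dW S 0) (dW'_real S 0) (dW_real S 0) hpos₂ hpos₀ w,
    linePlacePoly_letter_indep V (dW' S 1) (dW S 1) (dW'_real S 1) (dW_real S 1) hpos₃ hpos₁ w]

/-- the two columns of the UNPRIMED box carry the same line polynomial, too. -/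
theorem slotPlacePoly_eq_mul_same (w : {v : InfinitePlace (↥(maximalRealSubfield (L : Type))) // v.IsReal}) :
    slotPlacePoly V S hpos₀ hpos₁ w =
      rename (fun i => slotCol (Sum.inl i))
          (linePlacePoly Empty (L : Type) e₁ (frameD V) (frameD_real V) (lineVec (L : Type) (dW S 0)) (fun _ => dW_real S 0) ι₁
            (blockPosEquiv V) (blockNegEquiv V) (posIdxEquivUnit hpos₀) (negIdxEquivEmpty hpos₀) (Pi.single 0 1) w) *
        rename (fun i => slotCol (Sum.inr i))
          (linePlacePoly Empty (L : Type) e₁ (frameD V) (frameD_real V) (lineVec (L : Type) (dW S 0)) (fun _ => dW_real S 0) ι₁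
            (blockPosEquiv V) (blockNegEquiv V) (posIdxEquivUnit hpos₀) (negIdxEquivEmpty hpos₀) (Pi.single 0 1) w) := by
  unfold slotPlacePoly
  rw [linePlacePoly_letter_indep V (dW S 1) (dW S 0) (dW_real S 1) (dW_real S 0) hpos₁ hpos₀ w]

/-- **the primed slot box is the primed-frame Fock vector of the UNPRIMED place product.** -/
theorem slotArchBox_linePhi_dW'_eq_follandFock :
    slotArchBox (linePhi V (dW' S 0) (dW'_real S 0) (dW'_ne S 0) hpos₂) (linePhi V (dW' S 1) (dW'_real S 1) (dW'_ne S 1) hpos₃) =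
      follandFock (planeFrame V (dW' S) (dW'_real S) (dW'_ne S)) (∏ w, rename (atPlace w) (slotPlacePoly V S hpos₀ hpos₁ w)) := by
  rw [show slotArchBox (linePhi V (dW' S 0) (dW'_real S 0) (dW'_ne S 0) hpos₂) (linePhi V (dW' S 1) (dW'_real S 1) (dW'_ne S 1) hpos₃) =
      slotArchBox (linePhi V ((dW' S) 0) (dW'_real S 0) (dW'_ne S 0) hpos₂) (linePhi V ((dW' S) 1) (dW'_real S 1) (dW'_ne S 1) hpos₃) from rfl,
    slotArchBox_linePhi_eq_follandFock_of V (dW' S) (dW'_real S) (dW'_ne S) hpos₂ hpos₃]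
  simp only [slotPlacePolyOf_dW'_eq V S hpos₀ hpos₁ hpos₂ hpos₃]

end Indep

/-! ## §3 the column swap and the place-wise column relabelling -/

section ColPerm

variable {L : CMField} (S : StubTree.SeesawDatum L)

/-- **the column swap** of the plane index: `slotCol (inl i) ↔ slotCol (inr i)`. -/
def slotColSwap : Fin (3 * 2) ≃ Fin (3 * 2) := (slotCol.symm.trans (Equiv.sumComm (Fin 3) (Fin 3))).trans slotCol

/-- (Ported verbatim from the HodgeCMPerL package; no docstring in the source.) -/
@[simp] theorem slotColSwap_slotCol_inl (i : Fin 3) : slotColSwap (slotCol (Sum.inl i)) = slotCol (Sum.inr i) := by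
  simp [slotColSwap]

/-- (Ported verbatim from the HodgeCMPerL package; no docstring in the source.) -/
@[simp] theorem slotColSwap_slotCol_inr (i : Fin 3) : slotColSwap (slotCol (Sum.inr i)) = slotCol (Sum.inl i) := by
  simp [slotColSwap]

/-- (Ported verbatim from the HodgeCMPerL package; no docstring in the source.) -/
theorem slotColSwap_symm : slotColSwap.symm = slotColSwap := by
  refine Equiv.ext fun k => ?_
  obtain ⟨x, rfl⟩ := slotCol.surjective k
  rw [Equiv.symm_apply_eq]
  rcases x with i | i
  · rw [slotColSwap_slotCol_inl, slotColSwap_slotCol_inr]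
  · rw [slotColSwap_slotCol_inr, slotColSwap_slotCol_inl]

/-- the complex place of `L` over the real place `v` of `L⁺` at which (K7)'s bit is read. -/
abbrev placeUp (v : {v : InfinitePlace (↥(maximalRealSubfield (L : Type))) // v.IsReal}) : InfinitePlace (L : Type) :=
  (cmPlaceOver (L : Type) v).1

/-- **the column relabelling at the real place `v`**: the swap where the bit `conjSwapAt S (placeUp v)` is set, the identity elsewhere. -/
def colPermAt (v : {v : InfinitePlace (↥(maximalRealSubfield (L : Type))) // v.IsReal}) : Fin (3 * 2) ≃ Fin (3 * 2) :=
  if conjSwapAt S (placeUp v) then slotColSwap else Equiv.refl _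

/-- (Ported verbatim from the HodgeCMPerL package; no docstring in the source.) -/
theorem colPermAt_of {v : {v : InfinitePlace (↥(maximalRealSubfield (L : Type))) // v.IsReal}} (h : conjSwapAt S (placeUp v)) :
    colPermAt S v = slotColSwap := if_pos h

/-- (Ported verbatim from the HodgeCMPerL package; no docstring in the source.) -/
theorem colPermAt_of_not {v : {v : InfinitePlace (↥(maximalRealSubfield (L : Type))) // v.IsReal}} (h : ¬ conjSwapAt S (placeUp v)) :
    colPermAt S v = Equiv.refl _ := if_neg h

/-- (Ported verbatim from the HodgeCMPerL package; no docstring in the source.) -/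
theorem colPermAt_symm (v : {v : InfinitePlace (↥(maximalRealSubfield (L : Type))) // v.IsReal}) : (colPermAt S v).symm = colPermAt S v := by
  by_cases h : conjSwapAt S (placeUp v)
  · rw [colPermAt_of S h, slotColSwap_symm]
  · rw [colPermAt_of_not S h]; rfl

/-- `colPermAt` in line coordinates: `slotCol (inl i) ↦ slotCol (inl i)` or `slotCol (inr i)` — column `0 ↦ bitPerm 0`. -/
theorem colPermAt_slotCol_inl (v : {v : InfinitePlace (↥(maximalRealSubfield (L : Type))) // v.IsReal}) (i : Fin 3) :
    colPermAt S v (slotCol (Sum.inl i)) = finProdFinEquiv (i, bitPerm S (placeUp v) 0) := by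
  by_cases h : conjSwapAt S (placeUp v)
  · rw [colPermAt_of S h, slotColSwap_slotCol_inl, bitPerm_zero_of S _ h, ← finProdFinEquiv_symm_slotCol_inr, Equiv.apply_symm_apply]
  · rw [colPermAt_of_not S h, Equiv.refl_apply, bitPerm_of_not S _ h, ← finProdFinEquiv_symm_slotCol_inl, Equiv.apply_symm_apply]

/-- … and `slotCol (inr i) ↦ (i, bitPerm 1)`. -/
theorem colPermAt_slotCol_inr (v : {v : InfinitePlace (↥(maximalRealSubfield (L : Type))) // v.IsReal}) (i : Fin 3) :
    colPermAt S v (slotCol (Sum.inr i)) = finProdFinEquiv (i, bitPerm S (placeUp v) 1) := by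
  by_cases h : conjSwapAt S (placeUp v)
  · rw [colPermAt_of S h, slotColSwap_slotCol_inr, bitPerm_one_of S _ h, ← finProdFinEquiv_symm_slotCol_inl, Equiv.apply_symm_apply]
  · rw [colPermAt_of_not S h, Equiv.refl_apply, bitPerm_of_not S _ h, ← finProdFinEquiv_symm_slotCol_inr, Equiv.apply_symm_apply]

/-- **`colPermAt` IS `(i, j) ↦ (i, bitPerm j)`** in the plane's product index. -/
theorem colPermAt_finProdFinEquiv (v : {v : InfinitePlace (↥(maximalRealSubfield (L : Type))) // v.IsReal}) (i : Fin 3) (j : Fin 2) :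
    colPermAt S v (finProdFinEquiv (i, j)) = finProdFinEquiv (i, bitPerm S (placeUp v) j) := by
  revert j
  rw [Fin.forall_fin_two]
  refine ⟨?_, ?_⟩
  · rw [← finProdFinEquiv_symm_slotCol_inl, Equiv.apply_symm_apply, colPermAt_slotCol_inl]
  · rw [← finProdFinEquiv_symm_slotCol_inr, Equiv.apply_symm_apply, colPermAt_slotCol_inr]

/-- **the index relabelling of the plane's Folland coordinates**: `(k, v) ↦ (colPermAt S v k, v)` (an involution). -/
def conjColPerm :
    Fin (3 * 2) × {v : InfinitePlace (↥(maximalRealSubfield (L : Type))) // v.IsReal} ≃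
      Fin (3 * 2) × {v : InfinitePlace (↥(maximalRealSubfield (L : Type))) // v.IsReal} where
  toFun p := (colPermAt S p.2 p.1, p.2)
  invFun p := ((colPermAt S p.2).symm p.1, p.2)
  left_inv p := by simp
  right_inv p := by simp

/-- (Ported verbatim from the HodgeCMPerL package; no docstring in the source.) -/
@[simp] theorem conjColPerm_apply (k : Fin (3 * 2)) (v : {v : InfinitePlace (↥(maximalRealSubfield (L : Type))) // v.IsReal}) :
    conjColPerm S (k, v) = (colPermAt S v k, v) := rfl

/-- (Ported verbatim from the HodgeCMPerL package; no docstring in the source.) -/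
theorem conjColPerm_symm : (conjColPerm S).symm = conjColPerm S := by
  refine Equiv.ext fun p => ?_
  obtain ⟨k, v⟩ := p
  change ((colPermAt S v).symm k, v) = (colPermAt S v k, v)
  rw [colPermAt_symm]

/-- (Ported verbatim from the HodgeCMPerL package; no docstring in the source.) -/
theorem conjColPerm_comp_atPlace (w : {v : InfinitePlace (↥(maximalRealSubfield (L : Type))) // v.IsReal}) :
    (conjColPerm S) ∘ (atPlace w : Fin (3 * 2) → Fin (3 * 2) × {v : InfinitePlace (↥(maximalRealSubfield (L : Type))) // v.IsReal}) =
      (atPlace w) ∘ (colPermAt S w) := by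
  funext k
  rfl

variable {ι₁ : L →+* ℂ} (V : HermSpace3 L ι₁)
variable
  (hpos₀ : 0 < cmXW (L : Type) (frameD V) (lineVec (L : Type) (dW S 0)) (fun _ => dW_real S 0) ι₁ (HypCensus.cmPlace (L : Type) ι₁) 0)
  (hpos₁ : 0 < cmXW (L : Type) (frameD V) (lineVec (L : Type) (dW S 1)) (fun _ => dW_real S 1) ι₁ (HypCensus.cmPlace (L : Type) ι₁) 0)

/-- **the box's place polynomial is column-symmetric**: invariant under `colPermAt S w`. -/
theorem rename_colPermAt_slotPlacePoly (w : {v : InfinitePlace (↥(maximalRealSubfield (L : Type))) // v.IsReal}) :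
    rename (colPermAt S w) (slotPlacePoly V S hpos₀ hpos₁ w) = slotPlacePoly V S hpos₀ hpos₁ w := by
  by_cases h : conjSwapAt S (placeUp w)
  · rw [slotPlacePoly_eq_mul_same V S hpos₀ hpos₁ w, map_mul, MvPolynomial.rename_rename, MvPolynomial.rename_rename, colPermAt_of S h]
    have h₁ : (slotColSwap ∘ fun i : Fin 3 => slotCol (Sum.inl i)) = fun i => slotCol (Sum.inr i) := funext fun i => slotColSwap_slotCol_inl i
    have h₂ : (slotColSwap ∘ fun i : Fin 3 => slotCol (Sum.inr i)) = fun i => slotCol (Sum.inl i) := funext fun i => slotColSwap_slotCol_inr i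
    rw [h₁, h₂]
    exact mul_comm _ _
  · rw [colPermAt_of_not S h]
    exact MvPolynomial.rename_id_apply _

/-- **the place product is invariant under the relabelling `conjColPerm S`.** -/
theorem rename_conjColPerm_prod_slotPlacePoly :
    rename (conjColPerm S) (∏ w, rename (atPlace w) (slotPlacePoly V S hpos₀ hpos₁ w)) = ∏ w, rename (atPlace w) (slotPlacePoly V S hpos₀ hpos₁ w) := by
  rw [map_prod]
  refine Finset.prod_congr rfl fun w _ => ?_
  rw [MvPolynomial.rename_rename, conjColPerm_comp_atPlace, ← MvPolynomial.rename_rename, rename_colPermAt_slotPlacePoly]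

end ColPerm

/-! ## §4 the frame transport `J_S` and the headline `Φ_{X'} ∘ J_S = Φ_X` -/

section Transport

variable {L : CMField} {ι₁ : L →+* ℂ} (V : HermSpace3 L ι₁) (S : StubTree.SeesawDatum L)

/-- **the Folland-frame transport `J_S = 𝔢_{X'}⁻¹ ∘ (relabel by conjColPerm S) ∘ 𝔢_X`**: a continuous linear automorphism of
`(L⁺ ⊗ ℝ)^{3·2}` carrying the frame of the plane `X = V ⊗ ⟨dW S⟩` to the frame of the primed plane `X' = V ⊗ ⟨dW' S⟩` with the two line
columns swapped under the places where (K7)'s bit is set (coordinates: §5). -/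
def conjFrameTransport :
    (Fin (3 * 2) → mixedSpace (↥(maximalRealSubfield (L : Type)))) ≃L[ℝ] (Fin (3 * 2) → mixedSpace (↥(maximalRealSubfield (L : Type)))) :=
  (slotFrame V S).trans ((relabelCLE (conjColPerm S)).trans (planeFrame V (dW' S) (dW'_real S) (dW'_ne S)).symm)

/-- (Ported verbatim from the HodgeCMPerL package; no docstring in the source.) -/
theorem conjFrameTransport_apply (y : Fin (3 * 2) → mixedSpace (↥(maximalRealSubfield (L : Type)))) :
    conjFrameTransport V S y = (planeFrame V (dW' S) (dW'_real S) (dW'_ne S)).symm (relabelCLE (conjColPerm S) (slotFrame V S y)) := rfl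

/-- (Ported verbatim from the HodgeCMPerL package; no docstring in the source.) -/
theorem planeFrame_conjFrameTransport (y : Fin (3 * 2) → mixedSpace (↥(maximalRealSubfield (L : Type)))) :
    planeFrame V (dW' S) (dW'_real S) (dW'_ne S) (conjFrameTransport V S y) = relabelCLE (conjColPerm S) (slotFrame V S y) := by
  rw [conjFrameTransport_apply, ContinuousLinearEquiv.apply_symm_apply]

/-- a primed-frame Fock vector along `J_S` is the unprimed-frame Fock vector of the relabelled polynomial. -/
theorem follandFock_planeFrame_dW'_conjFrameTransport
    (F : MvPolynomial (Fin (3 * 2) × {v : InfinitePlace (↥(maximalRealSubfield (L : Type))) // v.IsReal}) ℂ)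
    (y : Fin (3 * 2) → mixedSpace (↥(maximalRealSubfield (L : Type)))) :
    follandFock (planeFrame V (dW' S) (dW'_real S) (dW'_ne S)) F (conjFrameTransport V S y) =
      follandFock (slotFrame V S) (rename (conjColPerm S) F) y := by
  rw [follandFock, follandFock, schwartzTransport_symm_apply, schwartzTransport_symm_apply, planeFrame_conjFrameTransport,
    ← schwartzTransport_symm_apply (relabelCLE (conjColPerm S)) (binvPi F), schwartzTransport_relabelCLE_symm_binvPi, conjColPerm_symm]

variable
  (hpos₀ : 0 < cmXW (L : Type) (frameD V) (lineVec (L : Type) (dW S 0)) (fun _ => dW_real S 0) ι₁ (HypCensus.cmPlace (L : Type) ι₁) 0)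
  (hpos₁ : 0 < cmXW (L : Type) (frameD V) (lineVec (L : Type) (dW S 1)) (fun _ => dW_real S 1) ι₁ (HypCensus.cmPlace (L : Type) ι₁) 0)
  (hpos₂ : 0 < cmXW (L : Type) (frameD V) (lineVec (L : Type) (dW' S 0)) (fun _ => dW'_real S 0) ι₁ (HypCensus.cmPlace (L : Type) ι₁) 0)
  (hpos₃ : 0 < cmXW (L : Type) (frameD V) (lineVec (L : Type) (dW' S 1)) (fun _ => dW'_real S 1) ι₁ (HypCensus.cmPlace (L : Type) ι₁) 0)

/-- **HEADLINE — `Φ_{X'} (J_S y) = Φ_X y`**: the primed slot box along the frame transport is the unprimed slot box. -/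
theorem slotArchBox_linePhi_conjFrameTransport (y : Fin (3 * 2) → mixedSpace (↥(maximalRealSubfield (L : Type)))) :
    slotArchBox (linePhi V (dW' S 0) (dW'_real S 0) (dW'_ne S 0) hpos₂) (linePhi V (dW' S 1) (dW'_real S 1) (dW'_ne S 1) hpos₃)
        (conjFrameTransport V S y) =
      slotArchBox (linePhi V (dW S 0) (dW_real S 0) (dW_ne S 0) hpos₀) (linePhi V (dW S 1) (dW_real S 1) (dW_ne S 1) hpos₁) y := by
  rw [slotArchBox_linePhi_dW'_eq_follandFock V S hpos₀ hpos₁ hpos₂ hpos₃, slotArchBox_linePhi_eq_follandFock V S hpos₀ hpos₁,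
    follandFock_planeFrame_dW'_conjFrameTransport, rename_conjColPerm_prod_slotPlacePoly]


-- port_pkg: scope closed for this part
end Transport
end HodgeCM.Model.ArchSideTerm
end
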